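import Summits.Ventures.CertifiedManyBodySolver.Upper.IntervalReaderBoxKernel
import Literature.MathematicalPhysics.QuantumLattice.HubbardNNNHopping

/-!
# Ventures/CertifiedManyBodySolver — Upper/IntervalReaderBoxClasses.lean: every `t–t′` two-graph class, the TORUS rows, and `den`
(part 24 of the Theorem-H1′ package; parts 1–23: `IntervalReaderSchur` … `IntervalReaderSourcedBoxDensity`)

HONEST FRAMING: first certified bounds; not a superconductivity verdict; every number certified or labelled
float.  This file certifies no number and moves no row; a box / torus energy is a variational CEILING.

Part 18 closed the multi-state route for the OPEN `t–t′` box (`hubbardOpenBoxTT'`, 34 of the 49 FORMAT-mps1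
objects) at `den = 1`.  The referee's two precisions on it (ref-2c g23, P4 / P5) are answered here:

* `twoGraph_sentence_of_reader` — the capstone for ANY two graphs `G₁, G₂` on ANY linearly ordered finite vertex
  type `Λ` read along a MONOTONE enumeration `e : Fin N ≃ Λ` (pulled-back graphs `G₁′, G₂′` on `Fin N`): bytes of
  the `H`-sweep over `twoGraphAutomaton G₁′ G₂′ t t′ U` and of the `Nrm`-sweep + the by-value ACCEPT test ⟹
  `Re ⟨Ψ, toSpin (hamiltonian G₁ t U + hamiltonian G₂ t′ 0) Ψ⟩ ≤ E · Re ⟨Ψ, Ψ⟩`, `Ψ = ψ ∘ (· ∘ e)`;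
* P5 — the TORUS class (the remaining 15 objects): `torusTT'_sentence_of_reader` for
  `hubbardRectTorusTT' a b t t′ U = hamiltonian (fermionRectTorusGraph a b) t U + hamiltonian (fermionRectTorusDiagGraph a b) t′ 0`
  (and `boxTT'_sentence_of_reader'`, part 18's statement re-derived from the generic one);
* P4 — `den` SCALING: `hamiltonian_mul_eq_smul` (`hamiltonian G (d·t) (d·U) = d • hamiltonian G t U`) and
  `twoGraph_sentence_of_reader_den`: the code runs the INTEGER automaton at `(d·t, d·t′, d·U)` and tests against
  `d·E` (`d = den > 0`); the conclusion is the sentence for `(t, t′, U)` and `E` — with the torus / box instances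
  `torusTT'_sentence_of_reader_den`, `boxTT'_sentence_of_reader_den`.
-/

noncomputable section

open Matrix Finset WithLp
open scoped BigOperators ComplexOrder Matrix.Norms.L2Operator

namespace Summit.Ventures.CertifiedManyBodySolver.Upper.IntervalReader

open Literature.MathematicalPhysics.QuantumLattice
open Literature.MathematicalPhysics.QuantumLattice.JordanWigner

/-! ## §NN  The generic two-graph class -/

section TwoGraph

variable {Λ : Type*} [LinearOrder Λ] [Fintype Λ] {N D : ℕ}

/-- **The multi-state reader encloses the two-graph matrix element** on any linearly ordered vertex type read along
a monotone enumeration (part 18's `reader_encloses_boxTT'_element`, generic). -/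
theorem reader_encloses_twoGraph_element (e : Fin N ≃ Λ) (he : ∀ i j, e i < e j ↔ i < j)
    (G₁ G₂ : SimpleGraph Λ) [DecidableRel G₁.Adj] [DecidableRel G₂.Adj]
    (G₁' G₂' : SimpleGraph (Fin N)) [DecidableRel G₁'.Adj] [DecidableRel G₂'.Adj]
    (hG₁ : ∀ k k', G₁'.Adj k k' ↔ G₁.Adj (e k) (e k')) (hG₂ : ∀ k k', G₂'.Adj k k' ↔ G₂.Adj (e k) (e k'))
    (t t' U : ℝ) (A : Fin N → MPSTensor 4 D)
    (κ : Fin N → ℝ) (hκ0 : ∀ k, 0 ≤ κ k)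
    (hκ : ∀ k (z : EuclideanSpace ℂ (Fin D)), ∑ s, ‖toLp 2 (A k s *ᵥ ofLp z)‖ ^ 2 ≤ κ k * ‖z‖ ^ 2)
    (M : Fin N → HState N → HState N → ℝ) (hM0 : ∀ k b' c, 0 ≤ M k b' c)
    (hMrow : ∀ k b' c s, ∑ s', ‖twoGraphAutomaton G₁' G₂' t t' U k b' c s s'‖ ≤ M k b' c)
    (hMcol : ∀ k b' c s', ∑ s, ‖twoGraphAutomaton G₁' G₂' t t' U k b' c s s'‖ ≤ M k b' c)
    (l l' r r' : Fin D → ℂ) (Yh : Fin (N + 1) → HState N → Matrix (Fin D) (Fin D) ℂ) (ρ : Fin N → HState N → ℝ)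
    (hρ : ∀ (k : Fin N) (c : HState N),
      ‖Yh k.succ c - ∑ b', transferOp (A k) (twoGraphAutomaton G₁' G₂' t t' U k b' c) (Yh k.castSucc b')‖ ≤ ρ k c)
    (rad : Fin (N + 1) → HState N → ℝ)
    (hr0 : ∀ b', ‖Yh 0 b' -
      (Pi.single HState.start (vecMulVec (star l) l') : HState N → Matrix (Fin D) (Fin D) ℂ) b'‖ ≤ rad 0 b')
    (hr : ∀ (k : Fin N) (c : HState N), ∑ b', M k b' c * κ k * rad k.castSucc b' + ρ k c ≤ rad k.succ c) :
    ‖star r ⬝ᵥ (Yh (Fin.last N) HState.fin *ᵥ r') -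
        star (fun k : TensorIndex Λ 4 => mpsOpenVar N A l r (fun i => k (e i))) ⬝ᵥ
          (toSpin (hamiltonian G₁ t U + hamiltonian G₂ t' 0) *ᵥ
            fun k : TensorIndex Λ 4 => mpsOpenVar N A l' r' (fun i => k (e i)))‖ ≤
      (∑ i, ‖r i‖) * (∑ j, ‖r' j‖) * rad (Fin.last N) HState.fin := by
  have hrel : star (fun k : TensorIndex Λ 4 => mpsOpenVar N A l r (fun i => k (e i))) ⬝ᵥ
        (toSpin (hamiltonian G₁ t U + hamiltonian G₂ t' 0) *ᵥ
          fun k : TensorIndex Λ 4 => mpsOpenVar N A l' r' (fun i => k (e i))) =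
      star (mpsOpenVar N A l r) ⬝ᵥ
        (toSpin (hamiltonian G₁' t U + hamiltonian G₂' t' 0) *ᵥ mpsOpenVar N A l' r') := by
    rw [map_add, add_mulVec, dotProduct_add, map_add, add_mulVec, dotProduct_add,
      inner_toSpin_hamiltonian_relabel e he _ G₁' hG₁, inner_toSpin_hamiltonian_relabel e he _ G₂' hG₂]
  rw [hrel]
  exact reader_encloses_matrix_element N A (twoGraphAutomaton G₁' G₂' t t' U) κ hκ0 hκ M hM0 hMrow hMcol
    HState.start HState.fin (toSpin (hamiltonian G₁' t U + hamiltonian G₂' t' 0))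
    (fun σ τ => by rw [← automatonKernel_twoGraphAutomaton_eq_toSpin G₁' G₂' t t' U, Matrix.of_apply])
    l l' r r' Yh ρ hρ rad hr0 hr

/-- **THE GENERIC TWO-GRAPH CAPSTONE — bytes ⇒ `Re⟨Ψ, toSpin (H_{G₁,t,U} + H_{G₂,t′,0}) Ψ⟩ ≤ E·Re⟨Ψ,Ψ⟩`.** -/
theorem twoGraph_sentence_of_reader (e : Fin N ≃ Λ) (he : ∀ i j, e i < e j ↔ i < j)
    (G₁ G₂ : SimpleGraph Λ) [DecidableRel G₁.Adj] [DecidableRel G₂.Adj]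
    (G₁' G₂' : SimpleGraph (Fin N)) [DecidableRel G₁'.Adj] [DecidableRel G₂'.Adj]
    (hG₁ : ∀ k k', G₁'.Adj k k' ↔ G₁.Adj (e k) (e k')) (hG₂ : ∀ k k', G₂'.Adj k k' ↔ G₂.Adj (e k) (e k'))
    (t t' U : ℝ) (A : Fin N → MPSTensor 4 D) (l r : Fin D → ℂ)
    (κ : Fin N → ℝ) (hκ0 : ∀ k, 0 ≤ κ k)
    (hκ : ∀ k (z : EuclideanSpace ℂ (Fin D)), ∑ s, ‖toLp 2 (A k s *ᵥ ofLp z)‖ ^ 2 ≤ κ k * ‖z‖ ^ 2)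
    (M : Fin N → HState N → HState N → ℝ) (hM0 : ∀ k b' c, 0 ≤ M k b' c)
    (hMrow : ∀ k b' c s, ∑ s', ‖twoGraphAutomaton G₁' G₂' t t' U k b' c s s'‖ ≤ M k b' c)
    (hMcol : ∀ k b' c s', ∑ s, ‖twoGraphAutomaton G₁' G₂' t t' U k b' c s s'‖ ≤ M k b' c)
    (YH : Fin (N + 1) → HState N → Matrix (Fin D) (Fin D) ℂ) (ρH : Fin N → HState N → ℝ)
    (hρH : ∀ (k : Fin N) (c : HState N),
      ‖YH k.succ c - ∑ b', transferOp (A k) (twoGraphAutomaton G₁' G₂' t t' U k b' c) (YH k.castSucc b')‖ ≤ ρH k c)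
    (radH : Fin (N + 1) → HState N → ℝ)
    (hrH0 : ∀ b', ‖YH 0 b' -
      (Pi.single HState.start (vecMulVec (star l) l) : HState N → Matrix (Fin D) (Fin D) ℂ) b'‖ ≤ radH 0 b')
    (hrH : ∀ (k : Fin N) (c : HState N), ∑ b', M k b' c * κ k * radH k.castSucc b' + ρH k c ≤ radH k.succ c)
    (YN : Fin (N + 1) → Matrix (Fin D) (Fin D) ℂ) (ρN : Fin N → ℝ)
    (hρN : ∀ k : Fin N, ‖YN k.succ - transferOp (A k) 1 (YN k.castSucc)‖ ≤ ρN k)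
    (radN : Fin (N + 1) → ℝ) (hrN0 : ‖YN 0 - vecMulVec (star l) l‖ ≤ radN 0)
    (hrN : ∀ k : Fin N, 1 * κ k * radN k.castSucc + ρN k ≤ radN k.succ)
    (E : ℝ)
    (hlo : (star r ⬝ᵥ (YH (Fin.last N) HState.fin *ᵥ r)).re + (∑ i, ‖r i‖) * (∑ i, ‖r i‖) * radH (Fin.last N)
        HState.fin ≤ E * ((star r ⬝ᵥ (YN (Fin.last N) *ᵥ r)).re - (∑ i, ‖r i‖) * (∑ i, ‖r i‖) * radN (Fin.last N)))
    (hhi : (star r ⬝ᵥ (YH (Fin.last N) HState.fin *ᵥ r)).re + (∑ i, ‖r i‖) * (∑ i, ‖r i‖) * radH (Fin.last N)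
        HState.fin ≤ E * ((star r ⬝ᵥ (YN (Fin.last N) *ᵥ r)).re + (∑ i, ‖r i‖) * (∑ i, ‖r i‖) * radN (Fin.last N))) :
    (star (fun k : TensorIndex Λ 4 => mpsOpenVar N A l r (fun i => k (e i))) ⬝ᵥ
        (toSpin (hamiltonian G₁ t U + hamiltonian G₂ t' 0) *ᵥ
          fun k : TensorIndex Λ 4 => mpsOpenVar N A l r (fun i => k (e i)))).re ≤
      E * (star (fun k : TensorIndex Λ 4 => mpsOpenVar N A l r (fun i => k (e i))) ⬝ᵥ
        fun k : TensorIndex Λ 4 => mpsOpenVar N A l r (fun i => k (e i))).re := by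
  have hH := reader_encloses_twoGraph_element e he G₁ G₂ G₁' G₂' hG₁ hG₂ t t' U A κ hκ0 hκ M hM0 hMrow hMcol l l r r
    YH ρH hρH radH hrH0 hrH
  have hNrm := reader_encloses_productOp_element N A (fun _ => (1 : Matrix (Fin 4) (Fin 4) ℂ)) κ hκ0 hκ
    (fun _ => (1 : ℝ)) (fun _ => zero_le_one) (fun _ s => (sum_norm_one_apply_row s).le)
    (fun _ s' => (sum_norm_one_apply_col s').le) (1 : Op (Fin N) 4) one_apply_eq_prod_one l l r r YN ρN
    hρN radN hrN0 hrN
  rw [Matrix.one_mulVec, ← star_compEquiv_dotProduct e] at hNrm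
  have hA := abs_re_sub_re_le_of_norm_sub_le hH
  have hB := abs_re_sub_re_le_of_norm_sub_le hNrm
  rw [← one_mul ((star (fun k : TensorIndex Λ 4 => mpsOpenVar N A l r (fun i => k (e i))) ⬝ᵥ
    (toSpin (hamiltonian G₁ t U + hamiltonian G₂ t' 0) *ᵥ
      fun k : TensorIndex Λ 4 => mpsOpenVar N A l r (fun i => k (e i)))).re)] at hA
  rw [← one_mul E] at hlo hhi
  exact accept_sound one_pos hB hA hlo hhi

/-! ## §OO  `den` scaling -/

omit [Fintype Λ] in
/-- The Hubbard Hamiltonian is linear in `(t, U)`: `hamiltonian G (d·t) (d·U) = d • hamiltonian G t U`. -/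
theorem hamiltonian_mul_eq_smul [Fintype Λ] (G : SimpleGraph Λ) [DecidableRel G.Adj] (d t U : ℝ) :
    hamiltonian G (d * t) (d * U) = (d : ℂ) • hamiltonian G t U := by
  simp only [hamiltonian, Complex.ofReal_mul, smul_add, smul_smul, smul_neg, neg_smul, mul_comm (d : ℂ)]

/-- **`den` scaling (ref-2c g23 P4).**  The code runs the INTEGER automaton at `(d·t, d·t′, d·U)` and tests against
`d·E` (`d = den > 0`, all weights integral); the conclusion is the sentence for `(t, t′, U)` and `E`. -/
theorem twoGraph_sentence_of_reader_den (d : ℝ) (hd : 0 < d) (e : Fin N ≃ Λ) (he : ∀ i j, e i < e j ↔ i < j)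
    (G₁ G₂ : SimpleGraph Λ) [DecidableRel G₁.Adj] [DecidableRel G₂.Adj]
    (G₁' G₂' : SimpleGraph (Fin N)) [DecidableRel G₁'.Adj] [DecidableRel G₂'.Adj]
    (hG₁ : ∀ k k', G₁'.Adj k k' ↔ G₁.Adj (e k) (e k')) (hG₂ : ∀ k k', G₂'.Adj k k' ↔ G₂.Adj (e k) (e k'))
    (t t' U : ℝ) (A : Fin N → MPSTensor 4 D) (l r : Fin D → ℂ)
    (κ : Fin N → ℝ) (hκ0 : ∀ k, 0 ≤ κ k)
    (hκ : ∀ k (z : EuclideanSpace ℂ (Fin D)), ∑ s, ‖toLp 2 (A k s *ᵥ ofLp z)‖ ^ 2 ≤ κ k * ‖z‖ ^ 2)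
    (M : Fin N → HState N → HState N → ℝ) (hM0 : ∀ k b' c, 0 ≤ M k b' c)
    (hMrow : ∀ k b' c s, ∑ s', ‖twoGraphAutomaton G₁' G₂' (d * t) (d * t') (d * U) k b' c s s'‖ ≤ M k b' c)
    (hMcol : ∀ k b' c s', ∑ s, ‖twoGraphAutomaton G₁' G₂' (d * t) (d * t') (d * U) k b' c s s'‖ ≤ M k b' c)
    (YH : Fin (N + 1) → HState N → Matrix (Fin D) (Fin D) ℂ) (ρH : Fin N → HState N → ℝ)
    (hρH : ∀ (k : Fin N) (c : HState N),
      ‖YH k.succ c - ∑ b', transferOp (A k) (twoGraphAutomaton G₁' G₂' (d * t) (d * t') (d * U) k b' c)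
        (YH k.castSucc b')‖ ≤ ρH k c)
    (radH : Fin (N + 1) → HState N → ℝ)
    (hrH0 : ∀ b', ‖YH 0 b' -
      (Pi.single HState.start (vecMulVec (star l) l) : HState N → Matrix (Fin D) (Fin D) ℂ) b'‖ ≤ radH 0 b')
    (hrH : ∀ (k : Fin N) (c : HState N), ∑ b', M k b' c * κ k * radH k.castSucc b' + ρH k c ≤ radH k.succ c)
    (YN : Fin (N + 1) → Matrix (Fin D) (Fin D) ℂ) (ρN : Fin N → ℝ)
    (hρN : ∀ k : Fin N, ‖YN k.succ - transferOp (A k) 1 (YN k.castSucc)‖ ≤ ρN k)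
    (radN : Fin (N + 1) → ℝ) (hrN0 : ‖YN 0 - vecMulVec (star l) l‖ ≤ radN 0)
    (hrN : ∀ k : Fin N, 1 * κ k * radN k.castSucc + ρN k ≤ radN k.succ)
    (E : ℝ)
    (hlo : (star r ⬝ᵥ (YH (Fin.last N) HState.fin *ᵥ r)).re + (∑ i, ‖r i‖) * (∑ i, ‖r i‖) * radH (Fin.last N)
        HState.fin ≤ (d * E) * ((star r ⬝ᵥ (YN (Fin.last N) *ᵥ r)).re -
          (∑ i, ‖r i‖) * (∑ i, ‖r i‖) * radN (Fin.last N)))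
    (hhi : (star r ⬝ᵥ (YH (Fin.last N) HState.fin *ᵥ r)).re + (∑ i, ‖r i‖) * (∑ i, ‖r i‖) * radH (Fin.last N)
        HState.fin ≤ (d * E) * ((star r ⬝ᵥ (YN (Fin.last N) *ᵥ r)).re +
          (∑ i, ‖r i‖) * (∑ i, ‖r i‖) * radN (Fin.last N))) :
    (star (fun k : TensorIndex Λ 4 => mpsOpenVar N A l r (fun i => k (e i))) ⬝ᵥ
        (toSpin (hamiltonian G₁ t U + hamiltonian G₂ t' 0) *ᵥ
          fun k : TensorIndex Λ 4 => mpsOpenVar N A l r (fun i => k (e i)))).re ≤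
      E * (star (fun k : TensorIndex Λ 4 => mpsOpenVar N A l r (fun i => k (e i))) ⬝ᵥ
        fun k : TensorIndex Λ 4 => mpsOpenVar N A l r (fun i => k (e i))).re := by
  have h := twoGraph_sentence_of_reader e he G₁ G₂ G₁' G₂' hG₁ hG₂ (d * t) (d * t') (d * U) A l r κ hκ0 hκ M hM0
    hMrow hMcol YH ρH hρH radH hrH0 hrH YN ρN hρN radN hrN0 hrN (d * E) hlo hhi
  have h0 : hamiltonian G₂ (d * t') 0 = hamiltonian G₂ (d * t') (d * 0) := by rw [mul_zero]
  rw [h0, hamiltonian_mul_eq_smul, hamiltonian_mul_eq_smul, ← smul_add, map_smul, smul_mulVec, dotProduct_smul,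
    smul_eq_mul, Complex.re_ofReal_mul, mul_assoc] at h
  exact le_of_mul_le_mul_left h hd

end TwoGraph

/-! ## §PP  The box and TORUS instances (ref-2c g23 P5) -/

section Instances

variable {a b D : ℕ}

/-- **The TORUS class** (`hubbardRectTorusTT'`, the 15 torus objects): bytes ⇒ the certificate sentence. -/
theorem torusTT'_sentence_of_reader (t t' U : ℝ) (e : Fin (a * b) ≃ (Fin a ×ₗ Fin b))
    (he : ∀ i j, e i < e j ↔ i < j)
    (G₁' G₂' : SimpleGraph (Fin (a * b))) [DecidableRel G₁'.Adj] [DecidableRel G₂'.Adj]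
    (hG₁ : ∀ k k', G₁'.Adj k k' ↔ (fermionRectTorusGraph a b).Adj (e k) (e k'))
    (hG₂ : ∀ k k', G₂'.Adj k k' ↔ (fermionRectTorusDiagGraph a b).Adj (e k) (e k'))
    (A : Fin (a * b) → MPSTensor 4 D) (l r : Fin D → ℂ)
    (κ : Fin (a * b) → ℝ) (hκ0 : ∀ k, 0 ≤ κ k)
    (hκ : ∀ k (z : EuclideanSpace ℂ (Fin D)), ∑ s, ‖toLp 2 (A k s *ᵥ ofLp z)‖ ^ 2 ≤ κ k * ‖z‖ ^ 2)
    (M : Fin (a * b) → HState (a * b) → HState (a * b) → ℝ) (hM0 : ∀ k b' c, 0 ≤ M k b' c)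
    (hMrow : ∀ k b' c s, ∑ s', ‖twoGraphAutomaton G₁' G₂' t t' U k b' c s s'‖ ≤ M k b' c)
    (hMcol : ∀ k b' c s', ∑ s, ‖twoGraphAutomaton G₁' G₂' t t' U k b' c s s'‖ ≤ M k b' c)
    (YH : Fin (a * b + 1) → HState (a * b) → Matrix (Fin D) (Fin D) ℂ) (ρH : Fin (a * b) → HState (a * b) → ℝ)
    (hρH : ∀ (k : Fin (a * b)) (c : HState (a * b)),
      ‖YH k.succ c - ∑ b', transferOp (A k) (twoGraphAutomaton G₁' G₂' t t' U k b' c) (YH k.castSucc b')‖ ≤ ρH k c)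
    (radH : Fin (a * b + 1) → HState (a * b) → ℝ)
    (hrH0 : ∀ b', ‖YH 0 b' -
      (Pi.single HState.start (vecMulVec (star l) l) : HState (a * b) → Matrix (Fin D) (Fin D) ℂ) b'‖ ≤ radH 0 b')
    (hrH : ∀ (k : Fin (a * b)) (c : HState (a * b)),
      ∑ b', M k b' c * κ k * radH k.castSucc b' + ρH k c ≤ radH k.succ c)
    (YN : Fin (a * b + 1) → Matrix (Fin D) (Fin D) ℂ) (ρN : Fin (a * b) → ℝ)
    (hρN : ∀ k : Fin (a * b), ‖YN k.succ - transferOp (A k) 1 (YN k.castSucc)‖ ≤ ρN k)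
    (radN : Fin (a * b + 1) → ℝ) (hrN0 : ‖YN 0 - vecMulVec (star l) l‖ ≤ radN 0)
    (hrN : ∀ k : Fin (a * b), 1 * κ k * radN k.castSucc + ρN k ≤ radN k.succ)
    (E : ℝ)
    (hlo : (star r ⬝ᵥ (YH (Fin.last (a * b)) HState.fin *ᵥ r)).re +
        (∑ i, ‖r i‖) * (∑ i, ‖r i‖) * radH (Fin.last (a * b)) HState.fin ≤
      E * ((star r ⬝ᵥ (YN (Fin.last (a * b)) *ᵥ r)).re - (∑ i, ‖r i‖) * (∑ i, ‖r i‖) * radN (Fin.last (a * b))))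
    (hhi : (star r ⬝ᵥ (YH (Fin.last (a * b)) HState.fin *ᵥ r)).re +
        (∑ i, ‖r i‖) * (∑ i, ‖r i‖) * radH (Fin.last (a * b)) HState.fin ≤
      E * ((star r ⬝ᵥ (YN (Fin.last (a * b)) *ᵥ r)).re + (∑ i, ‖r i‖) * (∑ i, ‖r i‖) * radN (Fin.last (a * b)))) :
    (star (fun k : TensorIndex (Fin a ×ₗ Fin b) 4 => mpsOpenVar (a * b) A l r (fun i => k (e i))) ⬝ᵥ
        (toSpin (hubbardRectTorusTT' a b t t' U) *ᵥ
          fun k : TensorIndex (Fin a ×ₗ Fin b) 4 => mpsOpenVar (a * b) A l r (fun i => k (e i)))).re ≤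
      E * (star (fun k : TensorIndex (Fin a ×ₗ Fin b) 4 => mpsOpenVar (a * b) A l r (fun i => k (e i))) ⬝ᵥ
        fun k : TensorIndex (Fin a ×ₗ Fin b) 4 => mpsOpenVar (a * b) A l r (fun i => k (e i))).re := by
  rw [hubbardRectTorusTT']
  exact twoGraph_sentence_of_reader e he _ _ G₁' G₂' hG₁ hG₂ t t' U A l r κ hκ0 hκ M hM0 hMrow hMcol YH ρH hρH radH
    hrH0 hrH YN ρN hρN radN hrN0 hrN E hlo hhi

/-- **The TORUS class at `den = d`** (integral automaton; test against `d·E`). -/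
theorem torusTT'_sentence_of_reader_den (d : ℝ) (hd : 0 < d) (t t' U : ℝ) (e : Fin (a * b) ≃ (Fin a ×ₗ Fin b))
    (he : ∀ i j, e i < e j ↔ i < j)
    (G₁' G₂' : SimpleGraph (Fin (a * b))) [DecidableRel G₁'.Adj] [DecidableRel G₂'.Adj]
    (hG₁ : ∀ k k', G₁'.Adj k k' ↔ (fermionRectTorusGraph a b).Adj (e k) (e k'))
    (hG₂ : ∀ k k', G₂'.Adj k k' ↔ (fermionRectTorusDiagGraph a b).Adj (e k) (e k'))
    (A : Fin (a * b) → MPSTensor 4 D) (l r : Fin D → ℂ)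
    (κ : Fin (a * b) → ℝ) (hκ0 : ∀ k, 0 ≤ κ k)
    (hκ : ∀ k (z : EuclideanSpace ℂ (Fin D)), ∑ s, ‖toLp 2 (A k s *ᵥ ofLp z)‖ ^ 2 ≤ κ k * ‖z‖ ^ 2)
    (M : Fin (a * b) → HState (a * b) → HState (a * b) → ℝ) (hM0 : ∀ k b' c, 0 ≤ M k b' c)
    (hMrow : ∀ k b' c s, ∑ s', ‖twoGraphAutomaton G₁' G₂' (d * t) (d * t') (d * U) k b' c s s'‖ ≤ M k b' c)
    (hMcol : ∀ k b' c s', ∑ s, ‖twoGraphAutomaton G₁' G₂' (d * t) (d * t') (d * U) k b' c s s'‖ ≤ M k b' c)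
    (YH : Fin (a * b + 1) → HState (a * b) → Matrix (Fin D) (Fin D) ℂ) (ρH : Fin (a * b) → HState (a * b) → ℝ)
    (hρH : ∀ (k : Fin (a * b)) (c : HState (a * b)),
      ‖YH k.succ c - ∑ b', transferOp (A k) (twoGraphAutomaton G₁' G₂' (d * t) (d * t') (d * U) k b' c)
        (YH k.castSucc b')‖ ≤ ρH k c)
    (radH : Fin (a * b + 1) → HState (a * b) → ℝ)
    (hrH0 : ∀ b', ‖YH 0 b' -
      (Pi.single HState.start (vecMulVec (star l) l) : HState (a * b) → Matrix (Fin D) (Fin D) ℂ) b'‖ ≤ radH 0 b')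
    (hrH : ∀ (k : Fin (a * b)) (c : HState (a * b)),
      ∑ b', M k b' c * κ k * radH k.castSucc b' + ρH k c ≤ radH k.succ c)
    (YN : Fin (a * b + 1) → Matrix (Fin D) (Fin D) ℂ) (ρN : Fin (a * b) → ℝ)
    (hρN : ∀ k : Fin (a * b), ‖YN k.succ - transferOp (A k) 1 (YN k.castSucc)‖ ≤ ρN k)
    (radN : Fin (a * b + 1) → ℝ) (hrN0 : ‖YN 0 - vecMulVec (star l) l‖ ≤ radN 0)
    (hrN : ∀ k : Fin (a * b), 1 * κ k * radN k.castSucc + ρN k ≤ radN k.succ)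
    (E : ℝ)
    (hlo : (star r ⬝ᵥ (YH (Fin.last (a * b)) HState.fin *ᵥ r)).re +
        (∑ i, ‖r i‖) * (∑ i, ‖r i‖) * radH (Fin.last (a * b)) HState.fin ≤
      (d * E) * ((star r ⬝ᵥ (YN (Fin.last (a * b)) *ᵥ r)).re -
        (∑ i, ‖r i‖) * (∑ i, ‖r i‖) * radN (Fin.last (a * b))))
    (hhi : (star r ⬝ᵥ (YH (Fin.last (a * b)) HState.fin *ᵥ r)).re +
        (∑ i, ‖r i‖) * (∑ i, ‖r i‖) * radH (Fin.last (a * b)) HState.fin ≤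
      (d * E) * ((star r ⬝ᵥ (YN (Fin.last (a * b)) *ᵥ r)).re +
        (∑ i, ‖r i‖) * (∑ i, ‖r i‖) * radN (Fin.last (a * b)))) :
    (star (fun k : TensorIndex (Fin a ×ₗ Fin b) 4 => mpsOpenVar (a * b) A l r (fun i => k (e i))) ⬝ᵥ
        (toSpin (hubbardRectTorusTT' a b t t' U) *ᵥ
          fun k : TensorIndex (Fin a ×ₗ Fin b) 4 => mpsOpenVar (a * b) A l r (fun i => k (e i)))).re ≤
      E * (star (fun k : TensorIndex (Fin a ×ₗ Fin b) 4 => mpsOpenVar (a * b) A l r (fun i => k (e i))) ⬝ᵥ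
        fun k : TensorIndex (Fin a ×ₗ Fin b) 4 => mpsOpenVar (a * b) A l r (fun i => k (e i))).re := by
  rw [hubbardRectTorusTT']
  exact twoGraph_sentence_of_reader_den d hd e he _ _ G₁' G₂' hG₁ hG₂ t t' U A l r κ hκ0 hκ M hM0 hMrow hMcol YH
    ρH hρH radH hrH0 hrH YN ρN hρN radN hrN0 hrN E hlo hhi

/-- **The open BOX class at `den = d`** (part 18's `boxTT'_sentence_of_reader` with the integral automaton;
ref-2c g23 P4: `den = 4` for the twenty `t′ = −¼` objects). -/
theorem boxTT'_sentence_of_reader_den (d : ℝ) (hd : 0 < d) (t t' U : ℝ) (e : Fin (a * b) ≃ (Fin a ×ₗ Fin b))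
    (he : ∀ i j, e i < e j ↔ i < j)
    (G₁' G₂' : SimpleGraph (Fin (a * b))) [DecidableRel G₁'.Adj] [DecidableRel G₂'.Adj]
    (hG₁ : ∀ k k', G₁'.Adj k k' ↔ (rectBoxGraph a b).Adj (e k) (e k'))
    (hG₂ : ∀ k k', G₂'.Adj k k' ↔ (rectBoxDiagGraph a b).Adj (e k) (e k'))
    (A : Fin (a * b) → MPSTensor 4 D) (l r : Fin D → ℂ)
    (κ : Fin (a * b) → ℝ) (hκ0 : ∀ k, 0 ≤ κ k)
    (hκ : ∀ k (z : EuclideanSpace ℂ (Fin D)), ∑ s, ‖toLp 2 (A k s *ᵥ ofLp z)‖ ^ 2 ≤ κ k * ‖z‖ ^ 2)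
    (M : Fin (a * b) → HState (a * b) → HState (a * b) → ℝ) (hM0 : ∀ k b' c, 0 ≤ M k b' c)
    (hMrow : ∀ k b' c s, ∑ s', ‖twoGraphAutomaton G₁' G₂' (d * t) (d * t') (d * U) k b' c s s'‖ ≤ M k b' c)
    (hMcol : ∀ k b' c s', ∑ s, ‖twoGraphAutomaton G₁' G₂' (d * t) (d * t') (d * U) k b' c s s'‖ ≤ M k b' c)
    (YH : Fin (a * b + 1) → HState (a * b) → Matrix (Fin D) (Fin D) ℂ) (ρH : Fin (a * b) → HState (a * b) → ℝ)
    (hρH : ∀ (k : Fin (a * b)) (c : HState (a * b)),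
      ‖YH k.succ c - ∑ b', transferOp (A k) (twoGraphAutomaton G₁' G₂' (d * t) (d * t') (d * U) k b' c)
        (YH k.castSucc b')‖ ≤ ρH k c)
    (radH : Fin (a * b + 1) → HState (a * b) → ℝ)
    (hrH0 : ∀ b', ‖YH 0 b' -
      (Pi.single HState.start (vecMulVec (star l) l) : HState (a * b) → Matrix (Fin D) (Fin D) ℂ) b'‖ ≤ radH 0 b')
    (hrH : ∀ (k : Fin (a * b)) (c : HState (a * b)),
      ∑ b', M k b' c * κ k * radH k.castSucc b' + ρH k c ≤ radH k.succ c)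
    (YN : Fin (a * b + 1) → Matrix (Fin D) (Fin D) ℂ) (ρN : Fin (a * b) → ℝ)
    (hρN : ∀ k : Fin (a * b), ‖YN k.succ - transferOp (A k) 1 (YN k.castSucc)‖ ≤ ρN k)
    (radN : Fin (a * b + 1) → ℝ) (hrN0 : ‖YN 0 - vecMulVec (star l) l‖ ≤ radN 0)
    (hrN : ∀ k : Fin (a * b), 1 * κ k * radN k.castSucc + ρN k ≤ radN k.succ)
    (E : ℝ)
    (hlo : (star r ⬝ᵥ (YH (Fin.last (a * b)) HState.fin *ᵥ r)).re +
        (∑ i, ‖r i‖) * (∑ i, ‖r i‖) * radH (Fin.last (a * b)) HState.fin ≤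
      (d * E) * ((star r ⬝ᵥ (YN (Fin.last (a * b)) *ᵥ r)).re -
        (∑ i, ‖r i‖) * (∑ i, ‖r i‖) * radN (Fin.last (a * b))))
    (hhi : (star r ⬝ᵥ (YH (Fin.last (a * b)) HState.fin *ᵥ r)).re +
        (∑ i, ‖r i‖) * (∑ i, ‖r i‖) * radH (Fin.last (a * b)) HState.fin ≤
      (d * E) * ((star r ⬝ᵥ (YN (Fin.last (a * b)) *ᵥ r)).re +
        (∑ i, ‖r i‖) * (∑ i, ‖r i‖) * radN (Fin.last (a * b)))) :
    (star (fun k : TensorIndex (Fin a ×ₗ Fin b) 4 => mpsOpenVar (a * b) A l r (fun i => k (e i))) ⬝ᵥ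
        (toSpin (hubbardOpenBoxTT' a b t t' U) *ᵥ
          fun k : TensorIndex (Fin a ×ₗ Fin b) 4 => mpsOpenVar (a * b) A l r (fun i => k (e i)))).re ≤
      E * (star (fun k : TensorIndex (Fin a ×ₗ Fin b) 4 => mpsOpenVar (a * b) A l r (fun i => k (e i))) ⬝ᵥ
        fun k : TensorIndex (Fin a ×ₗ Fin b) 4 => mpsOpenVar (a * b) A l r (fun i => k (e i))).re := by
  rw [hubbardOpenBoxTT']
  exact twoGraph_sentence_of_reader_den d hd e he _ _ G₁' G₂' hG₁ hG₂ t t' U A l r κ hκ0 hκ M hM0 hMrow hMcol YH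
    ρH hρH radH hrH0 hrH YN ρN hρN radN hrN0 hrN E hlo hhi

end Instances

end Summit.Ventures.CertifiedManyBodySolver.Upper.IntervalReader

end
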